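import Summits.RiemannHypothesis.RiemannHypothesis.Theorems.TiltedLandingLaw421R2NodeDR

/-! # TiltedLandingLaw421 — W-08 round 2R: INIT♯ AT THE TRACKED ROOT, PROVED ON ALL LEGAL DATA (C4 «kernel desk» §K.17 rev b — single tree import `…R2NodeDR`, rh-idea-6 g26; files-only cell: NOT proposed by C4)

The `k = 0` clause of the keyed stub `stub_zRestTrkDHFR′` (= clause (C) of `FlatRestGM` at `k = 0`, tree `tentTrkD_le_of_zRestTrkDHFR'` read it OFF the stub;
β′ᴿ hand census `pub/rh-split/rh-law421/betaR/StubZRestTrkDHFR.lean`: «INIT lemma: NOT PROVED»; director (CA327)(b): «the k-0 INIT♯ … AS A THEOREM»):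

  ★★★ `tentMeterTrkD_zero_le_purse` : `EngineHyps5 2 … → tentMeterTrkD (3/2) … 0 ≤ (Hs/s)² + B + 1 + 4 (hmax − rootHeight StTrkD …)/s`.

PROOF (W-07 c13 INIT transplanted to the booked root; inputs from `EngineHyps5 2` only): a lowest tracked level-0 state `u` is a column zero (`Re u = x₀`,
`0 < Im u = rootHeight ≤ min hmax Hs` — the column zero `w₀` of E5 bounds the root by `hmax`); its far tent `|Re z − x₀| ≤ (3/2)·Im u` with the pair
`{u, ū}` removed is counted by `ColumnBudgetMult` at radius `r = max s ((3/2) Im u) ≤ R`: `T + 2 ≤ 2r/s + B`; and `2r/s ≤ (Hs/s)² + 3 + 4(hmax − Im u)/s`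
because `7h ≤ 4 hmax + 3 Hs ≤ 4 hmax + Hs²/s + 3s` (`h ≤ hmax`, `h ≤ Hs`, `3 Hs s ≤ Hs² + 3 s²`).
SEAL-FREE, CLASS-FREE, α-FREE: a helper toward `stmt-RiemannHypothesis-24774` (`--supports … --as helper`), lands nothing by name. Typed ≠ proved for the stub; RH is NOT proved. -/

namespace RhW08.Round2

open Complex
open RhIdea6.G17.W07C7 RhIdea6.G17.W07C7.Rev6 RhIdea6.G18.W07C8.Law421BirthS RhIdea6.G19.W07C11.Seam
open RhIdea6.G20.W07C12.Frac RhIdea6.G20.W07C12.StColP RhW07.C12.FieldSplit RhIdea6.G21.W07C13.TentMax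
open RhW07.C14.TwoSided RhW07.C14.Classes RhW07.C14.Lineage RhW07.C14.Booking
open RhW07.C13.Heredity RhIdea6.G22.W07C15pre.Injection RhW07.E3.Cell RhW07.E3.Lit
open RhIdea6.G20.W07C13pre.Tent
open RhW08.Round1 RhW08.StSwap

section InitR

/-- (K) a tracked level-0 state is a column state: `StCol' … 0 u` and `Re u = x₀`. -/
theorem stCol'_re_of_stTrkD_zero {η : ℝ} {f : ℂ → ℂ} {x₀ s hmax R Hs : ℝ} {B : ℕ} {u : ℂ}
    (hu : StTrkD η f x₀ s hmax R Hs B 0 u) : StCol' η f x₀ s hmax R Hs B 0 u ∧ u.re = x₀ := by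
  obtain ⟨c, hc0, hre, hcu, -⟩ := hu
  subst hcu
  exact ⟨hc0, hre⟩

/-- (K) conversely, an upper column zero of a non-zero `f` is a tracked level-0 state (the constant chain). -/
theorem stTrkD_zero_of_stCol' {η : ℝ} {f : ℂ → ℂ} {x₀ s hmax R Hs : ℝ} {B : ℕ} {u : ℂ}
    (hu : StCol' η f x₀ s hmax R Hs B 0 u) (hre : u.re = x₀) : StTrkD η f x₀ s hmax R Hs B 0 u :=
  ⟨fun _ => u, hu, hre, rfl, fun m hm => absurd hm (Nat.not_lt_zero m)⟩

/-- (K) **the root is below the box top**: `rootHeight StTrkD … ≤ hmax` on every legal frame (E5's column zero `w₀`, reflected into the upper half-plane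
if necessary, is a tracked level-0 state of height `≤ hmax`; if `f = 0` the level is empty and the root height is `0`). -/
theorem rootHeight_stTrkD_le_hmax {η : ℝ} {f : ℂ → ℂ} {x₀ s hmax R Hs : ℝ} {B : ℕ} (hE : EngineHyps5 2 η f x₀ s hmax R Hs B) :
    rootHeight StTrkD η f x₀ s hmax R Hs B ≤ hmax := by
  obtain ⟨hdiff, hreal, -, hs, hCs, hChm, h3hm, -, hband, -, ⟨w₀, hw0, hwim, hwre, hwh⟩, -, -⟩ := hE
  by_cases hf : f = 0
  · have hempty : {u : ℂ | StTrkD η f x₀ s hmax R Hs B 0 u} = ∅ := by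
      ext u
      simp only [Set.mem_setOf_eq, Set.mem_empty_iff_false, iff_false]
      intro hu
      have h1 := (stCol'_re_of_stTrkD_zero hu).1.1
      simp only [iteratedDeriv_zero] at h1
      exact h1 hf
    unfold rootHeight
    rw [hempty, Set.image_empty, Real.sInf_empty]
    linarith
  · -- the upper representative of the pair {w₀, w̄₀}
    obtain ⟨v, hv0, hvim, hvre, hvh⟩ : ∃ v : ℂ, f v = 0 ∧ 0 < v.im ∧ v.re = x₀ ∧ v.im ≤ hmax := by
      rcases lt_or_gt_of_ne hwim with hneg | hpos
      · refine ⟨(starRingEnd ℂ) w₀, conj_zero_of_real_entire hdiff hreal hw0, ?_, ?_, ?_⟩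
        · rw [Complex.conj_im]; linarith
        · rw [Complex.conj_re]; exact hwre
        · rw [Complex.conj_im]
          have : |w₀.im| = -w₀.im := abs_of_neg hneg
          linarith
      · exact ⟨w₀, hw0, hpos, hwre, by
          have : |w₀.im| = w₀.im := abs_of_pos hpos
          linarith⟩
    have hvHs : v.im ≤ Hs := by
      have := hband v hv0
      rw [abs_of_pos hvim] at this
      exact this
    have hR : 0 < R := by linarith
    have hcol : StCol' η f x₀ s hmax R Hs B 0 v := by
      refine ⟨by simpa using hf, by simpa using hv0, hvim, ?_, hvHs⟩
      rw [hvre, sub_self, abs_zero]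
      push_cast
      linarith
    have hSt : StTrkD η f x₀ s hmax R Hs B 0 v := stTrkD_zero_of_stCol' hcol hvre
    unfold rootHeight
    calc sInf ((fun u : ℂ => |u.im|) '' {u : ℂ | StTrkD η f x₀ s hmax R Hs B 0 u}) ≤ |v.im| :=
          csInf_le ⟨0, fun b ⟨u, _, hb⟩ => hb ▸ abs_nonneg _⟩ ⟨v, hSt, rfl⟩
      _ ≤ hmax := by rw [abs_of_pos hvim]; exact hvh

/-- (K) the root height is attained at every lowest tracked level-0 state: `Im u = rootHeight StTrkD …`. -/
theorem im_eq_rootHeight_of_isLowest_zero {η : ℝ} {f : ℂ → ℂ} {x₀ s hmax R Hs : ℝ} {B : ℕ} {u : ℂ}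
    (hu : IsLowest StTrkD η f x₀ s hmax R Hs B 0 u) : u.im = rootHeight StTrkD η f x₀ s hmax R Hs B := by
  have hupos : 0 < u.im := (stCol'_re_of_stTrkD_zero hu.1).1.2.2.1
  unfold rootHeight
  apply le_antisymm
  · refine le_csInf ⟨|u.im|, u, hu.1, rfl⟩ ?_
    rintro b ⟨w, hw, rfl⟩
    have hwpos : 0 < w.im := (stCol'_re_of_stTrkD_zero hw).1.2.2.1
    show u.im ≤ |w.im|
    rw [abs_of_pos hwpos]
    exact hu.2 w hw
  · calc sInf ((fun u : ℂ => |u.im|) '' {u : ℂ | StTrkD η f x₀ s hmax R Hs B 0 u}) ≤ |u.im| :=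
          csInf_le ⟨0, fun b ⟨w, _, hb⟩ => hb ▸ abs_nonneg _⟩ ⟨u, hu.1, rfl⟩
      _ = u.im := abs_of_pos hupos

/-- ★★ (K) **INIT♯ PER COLUMN STATE** (the far 3/2-tent at a column zero of height `≤ hmax`):
`tentAt (3/2) f 0 u ≤ (Hs/s)² + B + 1 + 4 (hmax − Im u)/s`. Inputs from `EngineHyps5 2` only (entire, real, zero band `Hs`, `0 < s`, `2 hmax ≤ R`, `ColumnBudgetMult`). -/
theorem tentAt_column_le_purse {η : ℝ} {f : ℂ → ℂ} {x₀ s hmax R Hs : ℝ} {B : ℕ} (hE : EngineHyps5 2 η f x₀ s hmax R Hs B)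
    {u : ℂ} (hu : StCol' η f x₀ s hmax R Hs B 0 u) (hre : u.re = x₀) (hh : u.im ≤ hmax) :
    tentAt (3 / 2) f 0 u ≤ (Hs / s) ^ 2 + (B : ℝ) + 1 + 4 * (hmax - u.im) / s := by
  obtain ⟨hdiff, hreal, -, hs, hCs, hChm, h3hm, -, hband, hCHs, -, hCB, -⟩ := hE
  obtain ⟨hf0, hu0, huim, -, huHs⟩ := hu
  simp only [iteratedDeriv_zero] at hf0 hu0
  simp only [tentAt, iteratedDeriv_zero]
  -- the budget radius
  set r : ℝ := max s (3 / 2 * u.im) with hr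
  have hsr : s ≤ r := le_max_left _ _
  have hrR : r ≤ R := by
    apply max_le
    · nlinarith
    · nlinarith
  have hT : tentCount f u.re (3 / 2 * u.im) u + 2 ≤ stripCount f x₀ r := by
    refine tentCount_add_two_le_stripCount hdiff hf0 hreal hband hu0 huim ?_ ?_
    · intro z hz
      rw [hre] at hz
      exact hz.trans (le_max_right _ _)
    · rw [hre, sub_self, abs_zero]
      exact hs.le.trans hsr
  have hbud : stripCount f x₀ r - 2 * r / s ≤ B := hCB r hsr hrR
  -- 2r/s ≤ (Hs/s)² + 3 + 4 (hmax − h)/s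
  have hkey : 2 * r / s ≤ (Hs / s) ^ 2 + 3 + 4 * (hmax - u.im) / s := by
    have hs0 : s ≠ 0 := hs.ne'
    have hspare : 0 ≤ 4 * (hmax - u.im) / s := div_nonneg (by linarith) hs.le
    rcases le_total (3 / 2 * u.im) s with hcase | hcase
    · have hmax' : r = s := by rw [hr]; exact max_eq_left hcase
      rw [hmax']
      have : 2 * s / s = 2 := by field_simp
      rw [this]
      nlinarith [sq_nonneg (Hs / s)]
    · have hmax' : r = 3 / 2 * u.im := by rw [hr]; exact max_eq_right hcase
      rw [hmax', ← sub_nonneg]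
      have e : (Hs / s) ^ 2 + 3 + 4 * (hmax - u.im) / s - 2 * (3 / 2 * u.im) / s
          = (Hs ^ 2 + 3 * s ^ 2 + 4 * (hmax - u.im) * s - 3 * u.im * s) / s ^ 2 := by
        field_simp
      rw [e]
      refine div_nonneg ?_ (sq_nonneg s)
      nlinarith [sq_nonneg (Hs - 3 / 2 * s), sq_nonneg s, mul_nonneg hs.le (sub_nonneg.2 huHs), mul_nonneg hs.le (sub_nonneg.2 hh)]
  linarith

/-- ★★★ (K) **INIT♯ AT THE TRACKED ROOT — the `k = 0` clause of the keyed stub `stub_zRestTrkDHFR′`, PROVED on all legal data**: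
`T₀ᴿ = tentMeterTrkD (3/2) … 0 ≤ (Hs/s)² + B + 1 + 4 (hmax − rootHeight StTrkD …)/s`. (Seal-free, class-free, α-free.) -/
theorem tentMeterTrkD_zero_le_purse {η : ℝ} {f : ℂ → ℂ} {x₀ s hmax R Hs : ℝ} {B : ℕ} (hE : EngineHyps5 2 η f x₀ s hmax R Hs B) :
    tentMeterTrkD (3 / 2) η f x₀ s hmax R Hs B 0
      ≤ (Hs / s) ^ 2 + (B : ℝ) + 1 + 4 * (hmax - rootHeight StTrkD η f x₀ s hmax R Hs B) / s := by
  have hs : 0 < s := hE.2.2.2.1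
  have hroot : rootHeight StTrkD η f x₀ s hmax R Hs B ≤ hmax := rootHeight_stTrkD_le_hmax hE
  unfold tentMeterTrkD
  apply Real.sSup_le
  · rintro _ ⟨u, hu, rfl⟩
    have hcol := stCol'_re_of_stTrkD_zero hu.1
    have him : u.im = rootHeight StTrkD η f x₀ s hmax R Hs B := im_eq_rootHeight_of_isLowest_zero hu
    have hh : u.im ≤ hmax := by rw [him]; exact hroot
    have := tentAt_column_le_purse hE hcol.1 hcol.2 hh
    rw [him] at this
    exact this
  · have h0 : 0 ≤ 4 * (hmax - rootHeight StTrkD η f x₀ s hmax R Hs B) / s := div_nonneg (by linarith) hs.le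
    have h1 : 0 ≤ (Hs / s) ^ 2 := sq_nonneg _
    have h2 : (0 : ℝ) ≤ (B : ℝ) := Nat.cast_nonneg _
    linarith

/-- ★★ (K) INIT♯ in SETTLER units: the `k = 0` instance of the keyed REST — `σ_min(0) = max (0 − T₀ᴿ) 0 = 0 ≤ heightBudget (tentMeterTrkD (3/2)) StTrkD … = purse − T₀ᴿ`
(what `RestBudgetGF … (hB 0)` asks before any level is charged). -/
theorem sigmaMinTrkDR'_zero_le_heightBudget {η : ℝ} {f : ℂ → ℂ} {x₀ s hmax R Hs : ℝ} {B : ℕ} (hE : EngineHyps5 2 η f x₀ s hmax R Hs B) :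
    SigmaMinTrkDR' η f x₀ s hmax R Hs B 0 ≤ heightBudget (tentMeterTrkD (3 / 2)) StTrkD η f x₀ s hmax R Hs B := by
  have hT := tentMeterTrkD_zero_le_purse hE
  have hT0 : 0 ≤ tentMeterTrkD (3 / 2) η f x₀ s hmax R Hs B 0 := by
    unfold tentMeterTrkD
    apply Real.sSup_nonneg
    rintro _ ⟨u, -, rfl⟩
    exact tentAt_nonneg _ _ _ _
  simp only [SigmaMinTrkDR', sigmaMin, heightBudget]
  have hinj : injected PTrkD StTrkD ReadyR2 EmptyTrkD η f x₀ s hmax R Hs B 0 = 0 := by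
    simp [injected]
  rw [hinj]
  refine max_le ?_ ?_ <;> linarith

open Classical in
/-- ★★ (K) the same in FLAT-(C) units (`FlatRestGM` clause (C) at `k = 0`, any charge predicate / class): `T₀ᴿ + 0 ≤ purse`. -/
theorem flatC_zero {η : ℝ} {f : ℂ → ℂ} {x₀ s hmax R Hs : ℝ} {B : ℕ} (hE : EngineHyps5 2 η f x₀ s hmax R Hs B) (P : StatePred) (𝓔 : LevelClass)
    (lam : ℕ → ℝ) :
    tentMeterTrkD (3 / 2) η f x₀ s hmax R Hs B 0
        + (Finset.range 0).sum (fun j => if Charged P StTrkD ReadyR2 η f x₀ s hmax R Hs B j then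
            ((if 𝓔 η f x₀ s hmax R Hs B j then (1 : ℝ) else 0) + lam j / (1 / 4 * s)) else 0)
      ≤ (Hs / s) ^ 2 + (B : ℝ) + 1 + 4 * (hmax - rootHeight StTrkD η f x₀ s hmax R Hs B) / s := by
  rw [Finset.sum_range_zero, add_zero]
  exact tentMeterTrkD_zero_le_purse hE

end InitR

end RhW08.Round2
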